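import Summits.CriticalPhenomena.CardyFormulaZ2.Theses.CardyDualCurrent

/-!
# `TemplateCanonicalLimit` (stmt-CriticalPhenomena-11393): its place in the route, in Lean

Route `CardyDualCurrent`, sub-problem `CriticalPhenomena/CardyFormulaZ2`. The support item
`TemplateCanonicalLimit` (DCS Conjecture 8.7 / Smirnov 2010 Conjecture 2.4 at `q = 1`, `σ = 1/3`,
asked for SOME finite-range local parafermionic template, along every admissible square-lattice
discretisation family and every chordal uniformizer) is an open problem; this file records the
three structural facts a prover can certify about it today.

* `templateCanonicalLimit_of_cruxes` — it is literally the consequent of the crux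
  `CanonicalLimitFromExactCR` (stmt-11394) applied to the crux `DualCurrentTemplateR`
  (stmt-11201): closing r2 and r4 closes this item mechanically.
* `cardyFormulaZ2_of_templateCanonicalLimit` — conversely, proving it outright makes r2 and r4
  unnecessary: with `MartingaleToSLE6` (stmt-11395) and `SLE6ToCardy` (stmt-10278) it gives
  `CardyFormulaZ2` (the planner's "proving it outright closes r2's purpose and r4").
* `templateCanonicalLimit_of_vertexObservable` — the range-`0`, one-term member of the template
  class is Smirnov's vertex parafermionic observable `F_δ(z) = E[Σ_{passages} e^{-isW}]`; the
  family/chordal form of DCS Conjecture 8.7 for it (any real spin `s`, some lattice constant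
  `C > 0`) implies the item (template `r = 0`, `m = 1`, `z = s(0, eᵢ)`, `g ≡ 1`).

All three are definitional unfoldings; no analysis is involved.
-/

namespace Summit.CriticalPhenomena.CardyFormulaZ2.Theorems

open Summit.CriticalPhenomena.CardyFormulaZ2.Theses.CardyDualCurrent
open Literature.Probability.LatticeModels Literature.Probability.RandomPlanarGeometry
open Literature.Probability.Percolation
open Filter Topology MeasureTheory

/-- `TemplateCanonicalLimit` is the consequent of `CanonicalLimitFromExactCR` (whose antecedent is
verbatim the body of `DualCurrentTemplateR`): the two cruxes r2, r4 of route `CardyDualCurrent`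
give the support item r9 by modus ponens. [folklore] -/
theorem templateCanonicalLimit_of_cruxes (h2 : DualCurrentTemplateR)
    (h4 : CanonicalLimitFromExactCR) : TemplateCanonicalLimit :=
  h4 h2

/-- Proving `TemplateCanonicalLimit` outright short-circuits the cruxes r2 (`DualCurrentTemplateR`)
and r4 (`CanonicalLimitFromExactCR`): together with r5 (`MartingaleToSLE6`, whose antecedent is
verbatim its body) and the payoff `SLE6ToCardy` it yields Cardy's formula on `ℤ²`. [folklore] -/
theorem cardyFormulaZ2_of_templateCanonicalLimit (h9 : TemplateCanonicalLimit)
    (h5 : MartingaleToSLE6) (h10 : SLE6ToCardy) : _root_.CardyFormulaZ2 :=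
  h10 (h5 h9)

/-- **The item follows from DCS Conjecture 8.7 in family/chordal form for Smirnov's vertex
observable.** If for some real spin `s` and lattice constant `C > 0` the one-point parafermionic
observable `F_δ(z) = ∫ passageSum (fkInterface (E δ) ω) δ s z dP_{1/2}` of the `p = 1/2` bond
percolation exploration interface satisfies `θ_δ · C · δ^{-1/3} · F_δ(s(x, x + eᵢ)) → q`
(`x = ⌊w/δ⌋`, `q³ = ψ'/ψ`) locally uniformly, for every Dobrushin domain, every
`ZdDiscretisationFamily`, every chordal uniformizer and both edge types, then
`TemplateCanonicalLimit` holds — with the range-`0` one-term template `z = s(0, eᵢ)`, spin `s`,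
local weight `g ≡ 1`. (Duminil-Copin–Smirnov 2012, Conj. 8.7; Smirnov 2010, Conj. 2.4, at
`q = 1`.) [cite: DuminilCopinSmirnov2012Lattice, Conj. 8.7] -/
theorem templateCanonicalLimit_of_vertexObservable
    (h : ∃ (s C : ℝ), 0 < C ∧
      ∀ (D : DobrushinDomain) (E : ℝ → DiscreteDobrushin), ZdDiscretisationFamily D E →
      ∀ (φ : ConformalEquiv UpperHalfPlane.upperHalfPlaneSet D.carrier),
        D.IsChordalUniformizing φ →
      ∀ q : ℂ → ℂ, DifferentiableOn ℂ q D.carrier →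
        (∀ w ∈ D.carrier, q w ^ 3 = deriv φ.symm w / φ.symm w) →
      ∃ θ : ℝ → ℂ, (∀ δ, ‖θ δ‖ = 1) ∧ ∀ i : Fin 2,
        TendstoLocallyUniformlyOn
          (fun (δ : ℝ) (w : ℂ) => θ δ * C * ((δ ^ (-(1 / 3 : ℝ)) : ℝ) : ℂ) *
            ∫ cfg, passageSum (fkInterface (E δ) cfg) (E δ).δ s
              (Sym2.map (· + (fun j => ⌊(if j = 0 then w.re else w.im) / δ⌋ : Site 2))
                s((0 : Site 2), Pi.single i 1))
              ∂(bondPercolation (zdGraph 2) half))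
          q (𝓝[>] (0 : ℝ)) D.carrier) :
    TemplateCanonicalLimit := by
  obtain ⟨s, C, hC, h⟩ := h
  refine ⟨0, 1, fun i _ => s((0 : Site 2), Pi.single i 1), fun _ _ => s, fun _ _ _ => 1, C, hC,
    ?_, ?_⟩
  · intro i k
    simp
  · intro G D E hE φ hφ q hq hq3
    obtain ⟨θ, hθ, hconv⟩ := h D E hE φ hφ q hq hq3
    refine ⟨θ, hθ, fun i => ?_⟩
    have hG : ∀ (D' : DiscreteDobrushin) (x : Site 2), G D' x i =
        ∫ cfg, passageSum (fkInterface D' cfg) D'.δ s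
          (Sym2.map (· + x) s((0 : Site 2), Pi.single i 1)) ∂(bondPercolation (zdGraph 2) half) := by
      intro D' x
      simp only [G, Finset.univ_unique, Fin.default_eq_zero, Finset.sum_singleton, one_mul]
    simp only [hG]
    exact hconv i

end Summit.CriticalPhenomena.CardyFormulaZ2.Theorems
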